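import Mathlib
import HarnessLib

/-!
# (C3) mechanism, kernel lemma (U): down a deep layer of a `p`-tower the norm operator
# `Σ_{j<p^n} φ^j` kills every `φ^{p^n}`-fixed element of a finite `p`-primary `φ`-module
# (cell `bsd-addord`, seat bsd-addord-w2-acc5 gen 0; crux `KatoKuriharaPortThreeShared` =
# stmt-BirchSwinnertonDyer-19560, residual input (C3) = THEOREM D's `hbad`; `--supports 19560`)

## Why (the place of this lemma in the removal of `hbad`; memo HOME/acc5/ACC5-C3-MECHANISM-g0.md §3)

At a bad place `w ∤ 3r` write `D = G_{ℚ_w} ⊇ D₀ = D ∩ G_{ℚ(μ_r)} ⊇ D_n = D ∩ G_{ℚ(μ_{3^n r})} ⊇ I = I_w`,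
`[D₀ : D_n] = 3^{n′}`, `F̃₀` = a Frobenius of `D₀`.  The descent obstruction of THEOREM D's class `κ_r` at `w`
is a cocycle with values in the universal norms `UN = ∩_n cores^{D₀}_{D_n} H¹(D_n, T₃E)` (Kato's
`IsEulerSystem.cores_p`), and the removal of `hbad` needs `UN ⊆ H¹_ur(D₀,T) = ker(res_I)` (memo §3):
by Mackey (`I ⊴ D`, `I ≤ D_n ⊴ D₀`) `res_I ∘ cores^{D₀}_{D_n} = Σ_{j<3^{n′}} (F̃₀^j)_* ∘ res_I`, and
`res_I H¹(D_n,T)` lies in the FINITE `3`-primary `F̃₀`-module `C = H¹(I,T)_tors`, in its `F̃₀^{3^{n′}}`-fixed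
part.  THIS FILE is the pure-algebra end of that step (no Galois group, no elliptic curve): for a finite
module `C` killed by `p^e` and an endomorphism `φ`,

* `exists_forall_pow_pow_apply_eq_self` — STABILISATION: there is `s` with
  `φ^{p^n} c = c ⟹ φ^{p^s} c = c` for all `n ≥ s` (the increasing chain `{c | φ^{p^n} c = c}` in the
  finite lattice `Set C` is eventually constant);
* `sum_range_mul_pow_apply_eq_nsmul` — `φ^m c = c ⟹ Σ_{j<a·m} φ^j c = a • Σ_{j<m} φ^j c`;
* **`exists_forall_sum_range_pow_pow_apply_eq_zero`** — there is `n₀` such that for all `n ≥ n₀` and all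
  `c` with `φ^{p^n} c = c`: `Σ_{j<p^n} φ^j c = 0` (`= p^{n−s} • Σ_{j<p^s} φ^j c`, and `p^e ∣ p^{n−s}`);
* `eq_zero_of_forall_exists_eq_sum_range_pow_pow` — hence an element that is such a norm from EVERY
  layer `n` (a universal norm) is `0`.

HONEST LIMITS: a TOOL lemma; closes nothing; the Mackey identity and the identification of
`res_I H¹(D_n,T)` inside `H¹(I,T)_tors` (inputs (L2), (L3) of the memo) are separate; nothing booked.
References: K. Rubin, *Euler Systems* (2000), §4.6 (not held; mechanism reconstructed in the memo);
B. Mazur, K. Rubin, Mem. AMS 799 (2004), App. A, Prop. A.2.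
-/

set_option linter.dupNamespace false

namespace Summit.BirchSwinnertonDyer.BirchSwinnertonDyer.Theorems.KimAtThreePortSharedC3

open Finset

variable {R : Type*} [CommRing R] {C : Type*} [AddCommGroup C] [Module R C]

/-- If `φ^m c = c` then `φ^{a·m} c = c`. [folklore] -/
theorem pow_mul_apply_eq_self_of_pow_apply_eq_self (φ : Module.End R C) {m : ℕ} {c : C}
    (hc : (φ ^ m) c = c) (a : ℕ) : (φ ^ (a * m)) c = c := by
  induction a with
  | zero => simp
  | succ a ih => rw [Nat.succ_mul, pow_add, Module.End.mul_apply, hc, ih]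

/-- If `φ^m c = c` then `φ^{a·m + j} c = φ^j c`. [folklore] -/
theorem pow_mul_add_apply_eq_of_pow_apply_eq_self (φ : Module.End R C) {m : ℕ} {c : C}
    (hc : (φ ^ m) c = c) (a j : ℕ) : (φ ^ (a * m + j)) c = (φ ^ j) c := by
  rw [add_comm, pow_add, Module.End.mul_apply, pow_mul_apply_eq_self_of_pow_apply_eq_self φ hc a]

/-- **Norm over `a` blocks**: if `φ^m c = c` then `Σ_{j<a·m} φ^j c = a • Σ_{j<m} φ^j c`. [folklore] -/
theorem sum_range_mul_pow_apply_eq_nsmul (φ : Module.End R C) {m : ℕ} {c : C}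
    (hc : (φ ^ m) c = c) (a : ℕ) :
    ∑ j ∈ range (a * m), (φ ^ j) c = a • ∑ j ∈ range m, (φ ^ j) c := by
  induction a with
  | zero => simp
  | succ a ih =>
    rw [Nat.succ_mul, Finset.sum_range_add, ih, succ_nsmul]
    congr 1
    exact Finset.sum_congr rfl fun j _ => pow_mul_add_apply_eq_of_pow_apply_eq_self φ hc a j

/-- The chain of fixed sets `n ↦ {c | φ^{p^n} c = c}` is increasing. [folklore] -/
theorem pow_pow_succ_apply_eq_self_of_pow_pow_apply_eq_self (φ : Module.End R C) (p : ℕ) {n : ℕ}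
    {c : C} (hc : (φ ^ (p ^ n)) c = c) : (φ ^ (p ^ (n + 1))) c = c := by
  rw [pow_succ, mul_comm]
  exact pow_mul_apply_eq_self_of_pow_apply_eq_self φ hc p

/-- Iterated: `φ^{p^n} c = c ⟹ φ^{p^m} c = c` for `n ≤ m`. [folklore] -/
theorem pow_pow_apply_eq_self_mono (φ : Module.End R C) (p : ℕ) {n m : ℕ} (hnm : n ≤ m)
    {c : C} (hc : (φ ^ (p ^ n)) c = c) : (φ ^ (p ^ m)) c = c := by
  induction hnm with
  | refl => exact hc
  | step _ ih => exact pow_pow_succ_apply_eq_self_of_pow_pow_apply_eq_self φ p ih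

/-- **STABILISATION of the fixed sets in a finite module**: there is a layer `s` such that for every
`n ≥ s`, every `c` fixed by `φ^{p^n}` is already fixed by `φ^{p^s}` (the increasing chain
`{c | φ^{p^n} c = c}` in the finite lattice `Set C` is eventually constant,
`WellFoundedGT.monotone_chain_condition`). [folklore] -/
theorem exists_forall_pow_pow_apply_eq_self [Finite C] (φ : Module.End R C) (p : ℕ) :
    ∃ s : ℕ, ∀ n, s ≤ n → ∀ c : C, (φ ^ (p ^ n)) c = c → (φ ^ (p ^ s)) c = c := by
  let a : ℕ →o Set C :=
    { toFun := fun n => {c : C | (φ ^ (p ^ n)) c = c}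
      monotone' := monotone_nat_of_le_succ fun n c hc =>
        pow_pow_succ_apply_eq_self_of_pow_pow_apply_eq_self φ p hc }
  obtain ⟨s, hs⟩ := WellFoundedGT.monotone_chain_condition a
  refine ⟨s, fun n hn c hc => ?_⟩
  have h : c ∈ a n := hc
  rwa [← hs n hn] at h

/-- **(U): the norm operator of a deep layer kills the fixed part.**  For a finite module `C` killed
by `p^e` and an endomorphism `φ` there is `n₀` such that for every `n ≥ n₀` and every `c` with
`φ^{p^n} c = c`: `Σ_{j<p^n} φ^j c = 0`.  Proof: with `s` from the stabilisation, for `n ≥ s + e`,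
`Σ_{j<p^n} φ^j c = p^{n−s} • Σ_{j<p^s} φ^j c` and `p^e ∣ p^{n−s}`.  Applied with `C = H¹(I_w, T₃E)_tors`,
`φ = (F̃₀)_*`: the restriction to inertia of a corestriction from a deep cyclotomic layer vanishes
(memo §3: universal norms are unramified at `T`-level).
[cite: MazurRubin2004, App. A Prop. A.2 (the local condition of [Ru6] Thm. 4.5.1 at the primes of Σ)] -/
theorem exists_forall_sum_range_pow_pow_apply_eq_zero [Finite C] (φ : Module.End R C) (p e : ℕ)
    (hC : ∀ c : C, p ^ e • c = 0) :
    ∃ n₀ : ℕ, ∀ n, n₀ ≤ n → ∀ c : C, (φ ^ (p ^ n)) c = c → ∑ j ∈ range (p ^ n), (φ ^ j) c = 0 := by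
  obtain ⟨s, hs⟩ := exists_forall_pow_pow_apply_eq_self φ p
  refine ⟨s + e, fun n hn c hc => ?_⟩
  have hsn : s ≤ n := le_trans (Nat.le_add_right s e) hn
  have hcs : (φ ^ (p ^ s)) c = c := hs n hsn c hc
  obtain ⟨d, hd⟩ := Nat.exists_eq_add_of_le hn
  -- `p^n = (p^d · p^e) · p^s`
  have hpn : p ^ n = (p ^ d * p ^ e) * p ^ s := by
    rw [hd, ← pow_add, ← pow_add]; congr 1; omega
  rw [hpn, sum_range_mul_pow_apply_eq_nsmul φ hcs, mul_nsmul', hC, nsmul_zero]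

/-- **Universal norms vanish**: if `u` is, for EVERY layer `n`, of the form `Σ_{j<p^n} φ^j c_n` with
`φ^{p^n} c_n = c_n`, then `u = 0` (take `n = n₀`). [folklore] -/
theorem eq_zero_of_forall_exists_eq_sum_range_pow_pow [Finite C] (φ : Module.End R C) (p e : ℕ)
    (hC : ∀ c : C, p ^ e • c = 0) {u : C}
    (hu : ∀ n : ℕ, ∃ c : C, (φ ^ (p ^ n)) c = c ∧ u = ∑ j ∈ range (p ^ n), (φ ^ j) c) :
    u = 0 := by
  obtain ⟨n₀, hn₀⟩ := exists_forall_sum_range_pow_pow_apply_eq_zero φ p e hC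
  obtain ⟨c, hc, rfl⟩ := hu n₀
  exact hn₀ n₀ le_rfl c hc

end Summit.BirchSwinnertonDyer.BirchSwinnertonDyer.Theorems.KimAtThreePortSharedC3
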